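import Mathlib.Topology.MetricSpace.Holder
import Mathlib.Analysis.Calculus.ContDiff.Basic
import Literature.Analysis.FluidPDE.LocalTypeI
import Literature.Analysis.FluidPDE.SuitableWeakRescaling
import Literature.Analysis.FluidPDE.NSSuitableESS
import HarnessLib

/-!
# Suitable weak solutions in parabolic balls: restriction, zoom to the unit ball, and transport
# of a smooth representative back

Analysis/FluidPDE proofs-only tools file (no definitions, no named facts) around the accepted class
`IsSuitableWeakSolutionInBall r z u p` (`LocalTypeI.lean`; Albritton–Barker 2019, Def. 2.1 after
Lin 1998: the accepted local notion `IsSuitableWeakSolutionOn` on the backward parabolic cylinder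
`Q(z, r) = ]t - r², t[ × B(x, r)` together with the global classes `u ∈ L^∞_t L²_x`, `∇u ∈ L²`,
`p ∈ L^{3/2}` on it) — the hypothesis class of the ε-regularity lemmas vendored from Seregin's
book (`seregin2014_thm14`, `seregin2014_lemma61`), which are printed at unit scale `Q = Q(0, 1)`
and are applied "by the Navier–Stokes scaling" (Seregin 2014, p. 100; Escauriaza–Seregin–Šverák
2003, §3: "making obvious scaling `ṽ(x,t) = R v(x₀ + Rx, t₀ + R²t)`, `p̃ = R² p(…)`"). Contents:

* `IsSuitableWeakSolutionOn.isSuitableWeakSolutionInBall`: a suitable weak solution on an open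
  `Q` is in the class on every parabolic ball whose closed box `[t - R², t] × B̄(x, R)` lies in `Q`
  (the global classes on the ball are the local classes of `IsSuitableWeakSolutionOn` on the
  compact box; CKN 1982, §2);
* `IsSuitableWeakSolutionInBall.zoom`: the zoom `U(s, y) = R u(t₁ + R² s, x₁ + R y)`,
  `P = R² p ∘ Φ`, `Φ(s, y) = (t₁ + R² s, x₁ + R y)`, carries the class on `Q(z₁, R)` to the class
  on `Q(0, 1)` (accepted covariances `IsSuitableWeakSolutionOn.stRescale`,
  `HasWeakSpatialGradientOn.stRescale` and the change-of-variables lemmas of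
  `SpaceTimeRescaling.lean`), with the smallness quantities transforming as
  `∫_{Q(0,1)} |U|³ = C(R; z₁)`, `∫_{Q(0,1)} |P|^{3/2} = D(R; z₁)` (`lintegral_cube_zoom`,
  `lintegral_pressure_zoom`; `C = cknC`, `D = cknD`);
* `exists_representative_of_zoom`: a representative `W` of `U` on `Q(0, 1/2)` with smooth slices
  and spatial derivatives of all orders Hölder continuous and bounded (the shape of the conclusion
  of `seregin2014_lemma61`) is transported back to the representative `V = R⁻¹ W ∘ Φ⁻¹` of `u` on
  `Q(z₁, R/2)` with the same properties (`D_x^k V(t, x) = R⁻¹ D^k W(Φ⁻¹(t,x)) ∘ (R⁻¹ id)^{⊗k}`,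
  `iteratedFDeriv_zoom_symm`; bounds scale by `R^{-(k+1)}`, Hölder exponents are kept).

Everything is elementary bookkeeping (Mathlib's `ContinuousLinearEquiv.iteratedFDerivWithin_comp_right`,
`iteratedFDeriv_comp_add_left`, `iteratedFDeriv_const_smul_apply'`, `HolderOnWith.comp`).

## References

* L. Caffarelli, R. Kohn, L. Nirenberg, Comm. Pure Appl. Math. 35 (1982) 771–831, §2 (scaling of
  (2.1)–(2.5) and of `A, C, D, E`). [`CaffarelliKohnNirenberg1982`]
* L. Escauriaza, G. Seregin, V. Šverák, Russ. Math. Surveys 58:2 (2003) 211–250, §3 (the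
  scaling sentence). [`EscauriazaSereginSverak2003`]
* G. Seregin, *Lecture Notes on Regularity Theory for the Navier–Stokes Equations*, World
  Scientific 2014, Ch. 6, §6.1 (Def. 6.1, Lemma 6.1; "Lemma 6.1 and the Navier–Stokes scaling",
  p. 100). [`Seregin2014`]
* D. Albritton, T. Barker, J. Math. Fluid Mech. 21 (2019), Def. 2.1. [`AlbrittonBarker2019`]
-/

noncomputable section

open MeasureTheory Set Function Filter Topology TopologicalSpace Metric Module
open scoped NNReal ENNReal ContDiff

namespace Literature.Analysis.FluidPDE

/-! ### Geometry of the zoom `Φ(s, y) = (t₁ + R² s, x₁ + R y)` -/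

section Geometry

variable {R : ℝ}

/-- The closed parabolic box `[t - R², t] × B̄(x, R)` is compact. [folklore] -/
theorem isCompact_Icc_prod_closedBall (z : ℝ × EuclideanSpace ℝ (Fin 3)) (R : ℝ) :
    IsCompact (Icc (z.1 - R ^ 2) z.1 ×ˢ closedBall z.2 R) :=
  isCompact_Icc.prod (isCompact_closedBall _ _)

/-- `Q(z, R) ⊆ [t - R², t] × B̄(x, R)`. [folklore] -/
theorem parabolicCylinder_subset_Icc_prod_closedBall (z : ℝ × EuclideanSpace ℝ (Fin 3)) (R : ℝ) :
    parabolicCylinder R z ⊆ Icc (z.1 - R ^ 2) z.1 ×ˢ closedBall z.2 R :=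
  prod_mono Ioo_subset_Icc_self ball_subset_closedBall

/-- **Preimages of parabolic cylinders under the zoom**: `Φ⁻¹(Q(z₁, ρ)) = Q(0, ρ/R)` for
`Φ(s, y) = (t₁ + R² s, x₁ + R y)`, `R > 0`. [folklore] -/
theorem zoom_preimage_parabolicCylinder (hR : 0 < R) (z₁ : ℝ × EuclideanSpace ℝ (Fin 3))
    (ρ : ℝ) :
    stAffine (R ^ 2) R z₁.1 z₁.2 ⁻¹' parabolicCylinder ρ z₁ =
      parabolicCylinder (ρ / R) (0 : ℝ × EuclideanSpace ℝ (Fin 3)) := by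
  have h := stAffine_preimage_cylinder_eq_parabolicCylinder one_pos hR z₁.1 z₁.2 ρ
  simp only [div_one] at h
  exact h

/-- In particular `Φ⁻¹(Q(z₁, R)) = Q(0, 1)`. [folklore] -/
theorem zoom_preimage_parabolicCylinder_self (hR : 0 < R) (z₁ : ℝ × EuclideanSpace ℝ (Fin 3)) :
    stAffine (R ^ 2) R z₁.1 z₁.2 ⁻¹' parabolicCylinder R z₁ =
      parabolicCylinder 1 (0 : ℝ × EuclideanSpace ℝ (Fin 3)) := by
  rw [zoom_preimage_parabolicCylinder hR, div_self hR.ne']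

/-- … and `Φ⁻¹(Q(z₁, R/2)) = Q(0, 1/2)`. [folklore] -/
theorem zoom_preimage_parabolicCylinder_half (hR : 0 < R) (z₁ : ℝ × EuclideanSpace ℝ (Fin 3)) :
    stAffine (R ^ 2) R z₁.1 z₁.2 ⁻¹' parabolicCylinder (R / 2) z₁ =
      parabolicCylinder (1 / 2) (0 : ℝ × EuclideanSpace ℝ (Fin 3)) := by
  rw [zoom_preimage_parabolicCylinder hR]
  congr 1
  field_simp

/-- The `Opens` form of `Φ⁻¹(Q(z₁, R)) = Q(0, 1)`. [folklore] -/
theorem zoom_stPreimage_parabolicCylinderOpens (hR : 0 < R) (z₁ : ℝ × EuclideanSpace ℝ (Fin 3)) :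
    stPreimage (R ^ 2) R z₁.1 z₁.2 (parabolicCylinderOpens R z₁) =
      parabolicCylinderOpens 1 (0 : ℝ × EuclideanSpace ℝ (Fin 3)) :=
  Opens.ext (zoom_preimage_parabolicCylinder_self hR z₁)

/-- `Φ` maps `Q(0, ρ/R)` into `Q(z₁, ρ)`. [folklore] -/
theorem zoom_mem_parabolicCylinder (hR : 0 < R) (z₁ : ℝ × EuclideanSpace ℝ (Fin 3)) {ρ : ℝ}
    {w : ℝ × EuclideanSpace ℝ (Fin 3)}
    (hw : w ∈ parabolicCylinder (ρ / R) (0 : ℝ × EuclideanSpace ℝ (Fin 3))) :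
    stAffine (R ^ 2) R z₁.1 z₁.2 w ∈ parabolicCylinder ρ z₁ := by
  rw [← mem_preimage, zoom_preimage_parabolicCylinder hR]
  exact hw

/-- The inverse zoom `Φ⁻¹(t, x) = ((t - t₁)/R², (x - x₁)/R)` maps `Q(z₁, ρ)` into `Q(0, ρ/R)`. [folklore] -/
theorem zoom_symm_mem_parabolicCylinder (hR : 0 < R) (z₁ : ℝ × EuclideanSpace ℝ (Fin 3)) {ρ : ℝ}
    {z : ℝ × EuclideanSpace ℝ (Fin 3)} (hz : z ∈ parabolicCylinder ρ z₁) :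
    stAffine (R ^ 2)⁻¹ R⁻¹ (-((R ^ 2)⁻¹ * z₁.1)) (-(R⁻¹ • z₁.2)) z ∈
      parabolicCylinder (ρ / R) (0 : ℝ × EuclideanSpace ℝ (Fin 3)) := by
  rw [← zoom_preimage_parabolicCylinder hR z₁ ρ, mem_preimage,
    ← stAffineHomeomorph_symm_eq (pow_pos hR 2).ne' hR.ne', stAffine_apply_symm]
  exact hz

end Geometry

/-! ### Suitable weak solutions in parabolic balls whose closure lies inside the domain -/

section Restrict

variable {Q : Opens (ℝ × EuclideanSpace ℝ (Fin 3))} {u : ℝ → EuclideanSpace ℝ (Fin 3) → EuclideanSpace ℝ (Fin 3)}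
  {p : ℝ → EuclideanSpace ℝ (Fin 3) → ℝ}

/-- **A suitable weak solution on `Q` is a suitable weak solution in every parabolic ball whose
closed box `[t - R², t] × B̄(x, R)` lies in `Q`**, in the class of Albritton–Barker's Def. 2.1
(`IsSuitableWeakSolutionInBall`): the local notion restricts (`IsSuitableWeakSolutionOn.of_le`),
and the global classes `u ∈ L^∞_t L²_x`, `∇u ∈ L²`, `p ∈ L^{3/2}` on the ball are the local
classes of `IsSuitableWeakSolutionOn` on the compact box (CKN 1982, §2). [folklore] -/
theorem IsSuitableWeakSolutionOn.isSuitableWeakSolutionInBall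
    (h : IsSuitableWeakSolutionOn Q 1 0 u p) {z : ℝ × EuclideanSpace ℝ (Fin 3)} {R : ℝ}
    (hsub : Icc (z.1 - R ^ 2) z.1 ×ˢ closedBall z.2 R ⊆ (Q : Set (ℝ × EuclideanSpace ℝ (Fin 3)))) :
    IsSuitableWeakSolutionInBall R z u p := by
  set K : Set (ℝ × EuclideanSpace ℝ (Fin 3)) := Icc (z.1 - R ^ 2) z.1 ×ˢ closedBall z.2 R with hK
  have hKc : IsCompact K := isCompact_Icc_prod_closedBall z R
  have hQK : parabolicCylinder R z ⊆ K := parabolicCylinder_subset_Icc_prod_closedBall z R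
  have hle : parabolicCylinderOpens R z ≤ Q := fun w hw => hsub (hQK hw)
  refine ⟨h.of_le hle, ?_, ?_, ?_⟩
  · -- `u ∈ L^∞_t L²_x(Q(z, R))`
    obtain ⟨C, hC⟩ := h.energyClass K hsub hKc
    refine ⟨C, ?_⟩
    have hC' : ∀ᵐ t ∂(volume.restrict (Ioo (z.1 - R ^ 2) z.1)),
        ∫⁻ x, K.indicator (fun w : ℝ × EuclideanSpace ℝ (Fin 3) => ‖u w.1 w.2‖ₑ ^ 2) (t, x) ≤ C :=
      ae_restrict_of_ae hC
    filter_upwards [hC', ae_restrict_mem measurableSet_Ioo] with t ht htI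
    refine le_trans ?_ ht
    rw [← lintegral_indicator measurableSet_ball]
    refine lintegral_mono fun x => ?_
    by_cases hx : x ∈ ball z.2 R
    · rw [indicator_of_mem hx, indicator_of_mem (show (t, x) ∈ K from hQK ⟨htI, hx⟩)]
    · rw [indicator_of_notMem hx]
      exact bot_le
  · -- `∇u ∈ L²(Q(z, R))`
    obtain ⟨G, hG, hG2, -⟩ := h.localEnergy
    exact ⟨G, hG.mono hle, (lintegral_mono_set hQK).trans_lt (hG2 K hsub hKc)⟩
  · -- `p ∈ L^{3/2}(Q(z, R))`
    have hmeas : AEStronglyMeasurable (uncurry p) (volume.restrict (parabolicCylinder R z)) :=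
      (h.distributional.2.2.1.aestronglyMeasurable).mono_measure
        (Measure.restrict_mono (fun w hw => hle hw) le_rfl)
    refine ⟨hmeas, ?_⟩
    have h32 : ((3 : ℝ≥0∞) / 2).toReal = 3 / 2 := by
      rw [ENNReal.toReal_div]; norm_num
    have h32top : (3 : ℝ≥0∞) / 2 ≠ ⊤ := (ENNReal.div_lt_top (by simp) (by simp)).ne
    rw [eLpNorm_eq_lintegral_rpow_enorm_toReal (by norm_num) h32top, h32]
    refine ENNReal.rpow_lt_top_of_nonneg (by positivity) (ne_of_lt ?_)
    exact (lintegral_mono_set hQK).trans_lt (h.pressure K hsub hKc)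

end Restrict

/-! ### The zoom to the unit parabolic ball -/

section Zoom

variable {u : ℝ → EuclideanSpace ℝ (Fin 3) → EuclideanSpace ℝ (Fin 3)} {p : ℝ → EuclideanSpace ℝ (Fin 3) → ℝ}
  {R : ℝ} {z₁ : ℝ × EuclideanSpace ℝ (Fin 3)}

/-- `dim ℝ³ = 3` in the form produced by the change-of-variables lemmas. [folklore] -/
theorem ofReal_sq_mul_cube_inv (R : ℝ) :
    ENNReal.ofReal (R ^ 2 * R ^ finrank ℝ (EuclideanSpace ℝ (Fin 3)))⁻¹ = ENNReal.ofReal (R ^ 5)⁻¹ := by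
  rw [finrank_euclideanSpace_fin]
  congr 2
  ring

/-- **Zooming the cubic functional**: `∫_{Q(0,1)} |U|³ = C(R; z₁)` for `U = R u ∘ Φ`
(`R³ · R⁻⁵ ∫_{Q(z₁,R)} |u|³ = R⁻² ∫_{Q(z₁,R)} |u|³`; CKN 1982, §2, scale invariance of `C`). [folklore] -/
theorem lintegral_cube_zoom (hR : 0 < R) (z₁ : ℝ × EuclideanSpace ℝ (Fin 3))
    (u : ℝ → EuclideanSpace ℝ (Fin 3) → EuclideanSpace ℝ (Fin 3)) :
    ∫⁻ w in parabolicCylinder 1 (0 : ℝ × EuclideanSpace ℝ (Fin 3)),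
        ‖(R • stPull (R ^ 2) R z₁.1 z₁.2 u) w.1 w.2‖ₑ ^ (3 : ℕ) = cknC R z₁ u := by
  rw [← zoom_preimage_parabolicCylinder_self hR z₁,
    setLIntegral_enorm_pow_stRescale (pow_pos hR 2) hR z₁.1 z₁.2 R u _ 3, ofReal_sq_mul_cube_inv R,
    cknC, Real.enorm_eq_ofReal hR.le, ← ENNReal.ofReal_pow hR.le, ← ENNReal.ofReal_pow hR.le,
    ← ENNReal.ofReal_inv_of_pos (by positivity), ← ENNReal.ofReal_mul (by positivity)]
  congr 2
  field_simp

/-- **Zooming the pressure functional**: `∫_{Q(0,1)} |P|^{3/2} = D(R; z₁)` for `P = R² p ∘ Φ`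
(`(R²)^{3/2} R⁻⁵ ∫ = R⁻² ∫`). [folklore] -/
theorem lintegral_pressure_zoom (hR : 0 < R) (z₁ : ℝ × EuclideanSpace ℝ (Fin 3))
    (p : ℝ → EuclideanSpace ℝ (Fin 3) → ℝ) :
    ∫⁻ w in parabolicCylinder 1 (0 : ℝ × EuclideanSpace ℝ (Fin 3)),
        ‖(R ^ 2 • stPull (R ^ 2) R z₁.1 z₁.2 p) w.1 w.2‖ₑ ^ (3 / 2 : ℝ) = cknD R z₁ p := by
  rw [← zoom_preimage_parabolicCylinder_self hR z₁,
    setLIntegral_enorm_rpow_stRescale (pow_pos hR 2) hR z₁.1 z₁.2 (R ^ 2) p _ (by norm_num),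
    ofReal_sq_mul_cube_inv R, cknD, Real.enorm_eq_ofReal (sq_nonneg R),
    ENNReal.ofReal_rpow_of_nonneg (sq_nonneg R) (by norm_num), sq_rpow_three_halves hR.le,
    ← ENNReal.ofReal_pow hR.le, ← ENNReal.ofReal_inv_of_pos (by positivity),
    ← ENNReal.ofReal_mul (by positivity)]
  congr 2
  field_simp

/-- **The zoom of a suitable weak solution in `Q(z₁, R)` is a suitable weak solution in `Q(0, 1)`**
(Albritton–Barker 2019, Def. 2.1 is scale invariant): for `U(s, y) = R u(t₁ + R² s, x₁ + R y)`,
`P(s, y) = R² p(t₁ + R² s, x₁ + R y)`, the local notion is transported by the accepted covariance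
`IsSuitableWeakSolutionOn.stRescale` (`ν ↦ R · 1 / R = 1`), the energy class by slices
(`ae_sliced_setLIntegral_ball_stRescale`), the gradient by `HasWeakSpatialGradientOn.stRescale`
with `setLIntegral_frobeniusNormSq_stRescale`, the pressure class by
`setLIntegral_enorm_rpow_stRescale` (CKN 1982, §2; ESS 2003, §3 "making obvious scaling").
[folklore] -/
theorem IsSuitableWeakSolutionInBall.zoom (h : IsSuitableWeakSolutionInBall R z₁ u p) (hR : 0 < R) :
    IsSuitableWeakSolutionInBall 1 (0 : ℝ × EuclideanSpace ℝ (Fin 3))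
      (R • stPull (R ^ 2) R z₁.1 z₁.2 u) (R ^ 2 • stPull (R ^ 2) R z₁.1 z₁.2 p) := by
  obtain ⟨hsuit, ⟨C, hC⟩, ⟨G, hG, hG2⟩, hp⟩ := h
  have hR2 : 0 < R ^ 2 := pow_pos hR 2
  have hpre := zoom_stPreimage_parabolicCylinderOpens hR z₁
  have hpre' := zoom_preimage_parabolicCylinder_self hR z₁
  -- the local notion
  have hsuit1 : IsSuitableWeakSolutionOn (parabolicCylinderOpens 1 (0 : ℝ × EuclideanSpace ℝ (Fin 3))) 1 0
      (R • stPull (R ^ 2) R z₁.1 z₁.2 u) (R ^ 2 • stPull (R ^ 2) R z₁.1 z₁.2 p) := by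
    have h0 := hsuit.stRescale hR hR (sq R) z₁.1 z₁.2
    have hvisc : R * 1 / R = 1 := by field_simp
    have hforce : ((R ^ 2 * R) • stPull (R ^ 2) R z₁.1 z₁.2
        (0 : ℝ → EuclideanSpace ℝ (Fin 3) → EuclideanSpace ℝ (Fin 3))) = 0 := by
      funext s y; simp [stPull]
    rw [hvisc, hforce, hpre] at h0
    exact h0
  refine ⟨hsuit1, ?_, ?_, ?_⟩
  · -- energy class
    have hC0 : ∀ᵐ t ∂(volume.restrict (Ioo (z₁.1 + R ^ 2 * (-1)) (z₁.1 + R ^ 2 * 0))),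
        ∫⁻ x in ball z₁.2 R, ‖u t x‖ₑ ^ 2 ≤ (C : ℝ≥0∞) := by
      have e : Ioo (z₁.1 + R ^ 2 * (-1)) (z₁.1 + R ^ 2 * 0) = Ioo (z₁.1 - R ^ 2) z₁.1 := by
        congr 1 <;> ring
      rw [e]
      exact hC
    have h2 := ae_sliced_setLIntegral_ball_stRescale hR2 hR z₁.1 z₁.2 z₁.2 R (-1) 0
      (fun t x => ‖u t x‖ₑ ^ 2) hC0
    rw [finrank_euclideanSpace_fin, sub_self, smul_zero, div_self hR.ne'] at h2
    set C₁ : ℝ≥0∞ := ‖R‖ₑ ^ 2 * (ENNReal.ofReal (R ^ 3)⁻¹ * C) with hC₁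
    have hC₁top : C₁ ≠ ⊤ :=
      ENNReal.mul_ne_top (by simp) (ENNReal.mul_ne_top ENNReal.ofReal_ne_top ENNReal.coe_ne_top)
    refine ⟨C₁.toNNReal, ?_⟩
    rw [ENNReal.coe_toNNReal hC₁top]
    have hset : Ioo ((0 : ℝ × EuclideanSpace ℝ (Fin 3)).1 - 1 ^ 2) (0 : ℝ × EuclideanSpace ℝ (Fin 3)).1 =
        Ioo (-1 : ℝ) 0 := by simp
    rw [hset]
    filter_upwards [h2] with s hs
    have e : ∀ y : EuclideanSpace ℝ (Fin 3), ‖(R • stPull (R ^ 2) R z₁.1 z₁.2 u) s y‖ₑ ^ 2 =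
        ‖R‖ₑ ^ 2 * ‖u (z₁.1 + R ^ 2 * s) (z₁.2 + R • y)‖ₑ ^ 2 := by
      intro y
      rw [smul_stPull_apply, enorm_smul, mul_pow]
    simp only [e]
    rw [lintegral_const_mul' _ _ (by simp)]
    refine mul_le_mul' le_rfl ?_
    have e0 : (0 : ℝ × EuclideanSpace ℝ (Fin 3)).2 = 0 := rfl
    rw [e0]
    exact hs
  · -- the gradient
    refine ⟨(R * R) • stPull (R ^ 2) R z₁.1 z₁.2 G, ?_, ?_⟩
    · rw [← hpre]
      exact hG.stRescale R hR2 hR z₁.1 z₁.2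
    · show ∫⁻ w in parabolicCylinder 1 (0 : ℝ × EuclideanSpace ℝ (Fin 3)),
          ENNReal.ofReal (frobeniusNormSq (((R * R) • stPull (R ^ 2) R z₁.1 z₁.2 G) w.1 w.2)) < ⊤
      rw [← hpre', setLIntegral_frobeniusNormSq_stRescale hR2 hR z₁.1 z₁.2 (R * R) G]
      exact ENNReal.mul_lt_top (ENNReal.mul_lt_top ENNReal.ofReal_lt_top ENNReal.ofReal_lt_top) hG2
  · -- the pressure class
    refine ⟨hsuit1.distributional.2.2.1.aestronglyMeasurable, ?_⟩
    have h32 : ((3 : ℝ≥0∞) / 2).toReal = 3 / 2 := by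
      rw [ENNReal.toReal_div]; norm_num
    have h32top : (3 : ℝ≥0∞) / 2 ≠ ⊤ := (ENNReal.div_lt_top (by simp) (by simp)).ne
    rw [eLpNorm_eq_lintegral_rpow_enorm_toReal (by norm_num) h32top, h32]
    refine ENNReal.rpow_lt_top_of_nonneg (by positivity) (ne_of_lt ?_)
    show ∫⁻ w in parabolicCylinder 1 (0 : ℝ × EuclideanSpace ℝ (Fin 3)),
        ‖(R ^ 2 • stPull (R ^ 2) R z₁.1 z₁.2 p) w.1 w.2‖ₑ ^ (3 / 2 : ℝ) < ⊤
    rw [lintegral_pressure_zoom hR z₁ p, cknD]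
    have hp' := hp.eLpNorm_lt_top
    rw [eLpNorm_eq_lintegral_rpow_enorm_toReal (by norm_num) h32top, h32] at hp'
    have hfin : ∫⁻ w in parabolicCylinder R z₁, ‖p w.1 w.2‖ₑ ^ (3 / 2 : ℝ) < ⊤ := by
      have := (ENNReal.rpow_lt_top_iff_of_pos (by norm_num : (0 : ℝ) < 1 / (3 / 2))).1 hp'
      exact this
    exact ENNReal.mul_lt_top (ENNReal.inv_lt_top.2 (by positivity)) hfin

end Zoom

/-! ### Transport of a smooth representative back along the zoom -/

section Transport

variable {R : ℝ}

/-- **Spatial derivatives of the zoomed-back field.** For `W(s, ·)` smooth at the point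
`y = -R⁻¹x₁ + R⁻¹x`, the `k`-th derivative of `x' ↦ R⁻¹ W(s, -R⁻¹x₁ + R⁻¹x')` at `x` is `R⁻¹` times
the `k`-th derivative of `W(s, ·)` at `y` composed with `R⁻¹ · id` in each slot (chain rule for the
affine map `x' ↦ -R⁻¹x₁ + R⁻¹x'`; Mathlib's `ContinuousLinearEquiv.iteratedFDerivWithin_comp_right`,
`iteratedFDeriv_comp_add_left`, `iteratedFDeriv_const_smul_apply'`). [folklore] -/
theorem iteratedFDeriv_zoom_symm (hR : 0 < R) (f : EuclideanSpace ℝ (Fin 3) → EuclideanSpace ℝ (Fin 3))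
    (x₁ x : EuclideanSpace ℝ (Fin 3)) (k : ℕ)
    (hf : ContDiffAt ℝ ∞ f (-(R⁻¹ • x₁) + R⁻¹ • x)) :
    iteratedFDeriv ℝ k (fun x' => R⁻¹ • f (-(R⁻¹ • x₁) + R⁻¹ • x')) x =
      R⁻¹ • (iteratedFDeriv ℝ k f (-(R⁻¹ • x₁) + R⁻¹ • x)).compContinuousLinearMap
        (fun _ => R⁻¹ • ContinuousLinearMap.id ℝ (EuclideanSpace ℝ (Fin 3))) := by
  set L : EuclideanSpace ℝ (Fin 3) ≃L[ℝ] EuclideanSpace ℝ (Fin 3) :=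
    ContinuousLinearEquiv.equivOfInverse (R⁻¹ • ContinuousLinearMap.id ℝ (EuclideanSpace ℝ (Fin 3)))
      (R • ContinuousLinearMap.id ℝ (EuclideanSpace ℝ (Fin 3)))
      (fun y => by simp [smul_smul, hR.ne']) (fun y => by simp [smul_smul, hR.ne']) with hL
  have hLapply : ∀ y, L y = R⁻¹ • y := fun y => rfl
  have hLcoe : (L : EuclideanSpace ℝ (Fin 3) →L[ℝ] EuclideanSpace ℝ (Fin 3)) =
      R⁻¹ • ContinuousLinearMap.id ℝ (EuclideanSpace ℝ (Fin 3)) := rfl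
  set a : EuclideanSpace ℝ (Fin 3) := -(R⁻¹ • x₁) with ha
  set g : EuclideanSpace ℝ (Fin 3) → EuclideanSpace ℝ (Fin 3) := fun x' => f (a + R⁻¹ • x') with hg
  have hgcomp : g = (fun y => f (a + y)) ∘ L := by
    funext x'
    simp only [hg, comp_apply, hLapply]
  -- the derivative of `g`
  have h1 : iteratedFDeriv ℝ k g x =
      (iteratedFDeriv ℝ k f (a + R⁻¹ • x)).compContinuousLinearMap fun _ =>
        (L : EuclideanSpace ℝ (Fin 3) →L[ℝ] EuclideanSpace ℝ (Fin 3)) := by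
    have h := L.iteratedFDerivWithin_comp_right (fun y => f (a + y)) uniqueDiffOn_univ
      (x := x) (mem_univ _) k
    rw [preimage_univ, iteratedFDerivWithin_univ, iteratedFDerivWithin_univ, ← hgcomp,
      iteratedFDeriv_comp_add_left] at h
    rw [h, hLapply]
  -- `g` is smooth at `x`
  have haff : ContDiff ℝ ∞ fun x' : EuclideanSpace ℝ (Fin 3) => a + R⁻¹ • x' :=
    contDiff_const.add (contDiff_id.const_smul _)
  have hgx : ContDiffAt ℝ k g x := by
    have := hf.comp x haff.contDiffAt
    exact this.of_le (by exact_mod_cast le_top)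
  have h2 : iteratedFDeriv ℝ k (fun x' => R⁻¹ • g x') x = R⁻¹ • iteratedFDeriv ℝ k g x :=
    iteratedFDeriv_const_smul_apply' hgx
  show iteratedFDeriv ℝ k (fun x' => R⁻¹ • g x') x = _
  rw [h2, h1, hLcoe]

/-- The inverse zoom `z ↦ ((R²)⁻¹(t - t₁), R⁻¹(x - x₁))`, i.e. `stAffine (R²)⁻¹ R⁻¹ (…) (…)`, is
Lipschitz for the product metric with constant `max (R²)⁻¹ R⁻¹`. [folklore] -/
theorem lipschitzWith_stAffine {β γ : ℝ} (hβ : 0 ≤ β) (hγ : 0 ≤ γ) (t₀ : ℝ) (x₀ : EuclideanSpace ℝ (Fin 3)) :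
    LipschitzWith (max (Real.toNNReal β) (Real.toNNReal γ)) (stAffine β γ t₀ x₀) := by
  refine LipschitzWith.of_dist_le_mul fun z z' => ?_
  rw [Prod.dist_eq, Prod.dist_eq, stAffine_apply, stAffine_apply]
  simp only [dist_eq_norm, NNReal.coe_max, Real.coe_toNNReal _ hβ, Real.coe_toNNReal _ hγ]
  have h1 : ‖t₀ + β * z.1 - (t₀ + β * z'.1)‖ = β * ‖z.1 - z'.1‖ := by
    rw [show t₀ + β * z.1 - (t₀ + β * z'.1) = β * (z.1 - z'.1) by ring, norm_mul,
      Real.norm_of_nonneg hβ]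
  have h2 : ‖x₀ + γ • z.2 - (x₀ + γ • z'.2)‖ = γ * ‖z.2 - z'.2‖ := by
    rw [show x₀ + γ • z.2 - (x₀ + γ • z'.2) = γ • (z.2 - z'.2) by rw [smul_sub]; abel,
      norm_smul, Real.norm_of_nonneg hγ]
  rw [h1, h2]
  refine max_le ?_ ?_
  · exact mul_le_mul (le_max_left _ _) (le_max_left _ _) (norm_nonneg _)
      (hβ.trans (le_max_left _ _))
  · exact mul_le_mul (le_max_right _ _) (le_max_right _ _) (norm_nonneg _)
      (hβ.trans (le_max_left _ _))

variable {u : ℝ → EuclideanSpace ℝ (Fin 3) → EuclideanSpace ℝ (Fin 3)}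

/-- **Transport of a smooth representative back along the zoom.** Let `U = R u ∘ Φ`,
`Φ(s, y) = (t₁ + R² s, x₁ + R y)`, agree a.e. on `Q(0, 1/2)` with a field `W` whose slices are
smooth at the points of `Q(0, 1/2)` and whose spatial derivatives of every order are Hölder
continuous on `Q(0, 1/2)` and bounded there by `c k`. Then `V = R⁻¹ W ∘ Φ⁻¹` agrees a.e. with `u`
on `Q(z₁, R/2) = Φ(Q(0, 1/2))`, its slices are smooth at the points of `Q(z₁, R/2)`, its spatial
derivatives of every order are Hölder continuous on `Q(z₁, R/2)` (exponent unchanged) and bounded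
there by `R^{-(k+1)} c k` (`D_x^k V(t, x) = R⁻¹ D_y^k W(Φ⁻¹(t, x)) ∘ (R⁻¹ id)^{⊗k}`). This is the
bookkeeping behind "Lemma 6.1 and the Navier–Stokes scaling" (Seregin 2014, p. 100). [folklore] -/
theorem exists_representative_of_zoom (hR : 0 < R) (z₁ : ℝ × EuclideanSpace ℝ (Fin 3))
    {W : ℝ → EuclideanSpace ℝ (Fin 3) → EuclideanSpace ℝ (Fin 3)} {c : ℕ → ℝ}
    (hae : uncurry (R • stPull (R ^ 2) R z₁.1 z₁.2 u)
      =ᵐ[volume.restrict (parabolicCylinder (1 / 2) (0 : ℝ × EuclideanSpace ℝ (Fin 3)))] uncurry W)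
    (hcd : ∀ w ∈ parabolicCylinder (1 / 2) (0 : ℝ × EuclideanSpace ℝ (Fin 3)), ContDiffAt ℝ ∞ (W w.1) w.2)
    (hH : ∀ k : ℕ, ∃ C α : ℝ≥0, 0 < α ∧
      HolderOnWith C α (fun w : ℝ × EuclideanSpace ℝ (Fin 3) => iteratedFDeriv ℝ k (W w.1) w.2)
        (parabolicCylinder (1 / 2) (0 : ℝ × EuclideanSpace ℝ (Fin 3))))
    (hb : ∀ k : ℕ, ∀ w ∈ parabolicCylinder (1 / 2) (0 : ℝ × EuclideanSpace ℝ (Fin 3)),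
      ‖iteratedFDeriv ℝ k (W w.1) w.2‖ ≤ c k) :
    ∃ V : ℝ → EuclideanSpace ℝ (Fin 3) → EuclideanSpace ℝ (Fin 3),
      uncurry u =ᵐ[volume.restrict (parabolicCylinder (R / 2) z₁)] uncurry V ∧
      (∀ z ∈ parabolicCylinder (R / 2) z₁, ContDiffAt ℝ ∞ (V z.1) z.2) ∧
      (∀ k : ℕ, ∃ C α : ℝ≥0, 0 < α ∧
        HolderOnWith C α (fun z : ℝ × EuclideanSpace ℝ (Fin 3) => iteratedFDeriv ℝ k (V z.1) z.2)
          (parabolicCylinder (R / 2) z₁)) ∧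
      ∀ k : ℕ, ∀ z ∈ parabolicCylinder (R / 2) z₁,
        ‖iteratedFDeriv ℝ k (V z.1) z.2‖ ≤ R⁻¹ ^ (k + 1) * c k := by
  have hR0 : R ≠ 0 := hR.ne'
  have hR2 : 0 < R ^ 2 := pow_pos hR 2
  have hR20 : R ^ 2 ≠ 0 := hR2.ne'
  -- the inverse zoom `ψ = Φ⁻¹` and the representative `V = R⁻¹ W ∘ ψ`
  set ψ : ℝ × EuclideanSpace ℝ (Fin 3) → ℝ × EuclideanSpace ℝ (Fin 3) :=
    stAffine (R ^ 2)⁻¹ R⁻¹ (-((R ^ 2)⁻¹ * z₁.1)) (-(R⁻¹ • z₁.2)) with hψ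
  set V : ℝ → EuclideanSpace ℝ (Fin 3) → EuclideanSpace ℝ (Fin 3) :=
    R⁻¹ • stPull (R ^ 2)⁻¹ R⁻¹ (-((R ^ 2)⁻¹ * z₁.1)) (-(R⁻¹ • z₁.2)) W with hV
  have hVapply : ∀ t x, V t x =
      R⁻¹ • W (-((R ^ 2)⁻¹ * z₁.1) + (R ^ 2)⁻¹ * t) (-(R⁻¹ • z₁.2) + R⁻¹ • x) := fun t x => rfl
  have hψ1 : ∀ z : ℝ × EuclideanSpace ℝ (Fin 3), (ψ z).1 = -((R ^ 2)⁻¹ * z₁.1) + (R ^ 2)⁻¹ * z.1 :=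
    fun z => rfl
  have hψ2 : ∀ z : ℝ × EuclideanSpace ℝ (Fin 3), (ψ z).2 = -(R⁻¹ • z₁.2) + R⁻¹ • z.2 := fun z => rfl
  have hψmem : ∀ z ∈ parabolicCylinder (R / 2) z₁,
      ψ z ∈ parabolicCylinder (1 / 2) (0 : ℝ × EuclideanSpace ℝ (Fin 3)) := by
    intro z hz
    have := zoom_symm_mem_parabolicCylinder hR z₁ hz
    rwa [show R / 2 / R = 1 / 2 by field_simp] at this
  -- the slices of `V` at the points of `Q(z₁, R/2)`: smoothness and the derivative formula
  have hslice : ∀ z ∈ parabolicCylinder (R / 2) z₁,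
      ContDiffAt ℝ ∞ (W (ψ z).1) (-(R⁻¹ • z₁.2) + R⁻¹ • z.2) := by
    intro z hz
    have h := hcd (ψ z) (hψmem z hz)
    rwa [hψ2] at h
  have hformula : ∀ k, ∀ z ∈ parabolicCylinder (R / 2) z₁,
      iteratedFDeriv ℝ k (V z.1) z.2 =
        R⁻¹ • (iteratedFDeriv ℝ k (W (ψ z).1) (ψ z).2).compContinuousLinearMap
          (fun _ => R⁻¹ • ContinuousLinearMap.id ℝ (EuclideanSpace ℝ (Fin 3))) := by
    intro k z hz
    have h := iteratedFDeriv_zoom_symm hR (W (ψ z).1) z₁.2 z.2 k (hslice z hz)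
    have e : V z.1 = fun x' => R⁻¹ • W (ψ z).1 (-(R⁻¹ • z₁.2) + R⁻¹ • x') := by
      funext x'
      rw [hVapply, hψ1]
    rw [e, h, hψ2]
  refine ⟨V, ?_, ?_, ?_, ?_⟩
  · -- `u = V` a.e. on `Q(z₁, R/2) = Φ(Q(0, 1/2))`
    refine ae_restrict_of_ae_restrict_preimage_stAffine hR2 hR z₁.1 z₁.2
      (P := fun z => uncurry u z = uncurry V z) ?_
    rw [zoom_preimage_parabolicCylinder_half hR z₁]
    filter_upwards [hae] with w hw
    have hw' : R • u (z₁.1 + R ^ 2 * w.1) (z₁.2 + R • w.2) = W w.1 w.2 := by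
      have := hw
      simp only [uncurry, smul_stPull_apply] at this
      exact this
    have e := stPull_symm_apply_stAffine hR20 hR0 z₁.1 z₁.2 W w.1 w.2
    simp only [stPull_apply] at e
    simp only [uncurry, stAffine_fst, stAffine_snd]
    rw [hVapply, e, ← hw', smul_smul, inv_mul_cancel₀ hR0, one_smul]
  · -- smooth slices
    intro z hz
    have haff : ContDiff ℝ ∞ fun x' : EuclideanSpace ℝ (Fin 3) => -(R⁻¹ • z₁.2) + R⁻¹ • x' :=
      contDiff_const.add (contDiff_id.const_smul _)
    have h1 : ContDiffAt ℝ ∞ (fun x' => W (ψ z).1 (-(R⁻¹ • z₁.2) + R⁻¹ • x')) z.2 :=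
      (hslice z hz).comp z.2 haff.contDiffAt
    have e : V z.1 = fun x' => R⁻¹ • W (ψ z).1 (-(R⁻¹ • z₁.2) + R⁻¹ • x') := by
      funext x'
      rw [hVapply, hψ1]
    rw [e]
    exact h1.const_smul R⁻¹
  · -- Hölder continuity of the spatial derivatives
    intro k
    obtain ⟨C, α, hα, hHk⟩ := hH k
    -- the linear map `M ↦ R⁻¹ M ∘ (R⁻¹ id)^{⊗k}` and the Lipschitz inverse zoom
    set Ψ : ContinuousMultilinearMap ℝ (fun _ : Fin k => EuclideanSpace ℝ (Fin 3)) (EuclideanSpace ℝ (Fin 3)) →L[ℝ]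
        ContinuousMultilinearMap ℝ (fun _ : Fin k => EuclideanSpace ℝ (Fin 3)) (EuclideanSpace ℝ (Fin 3)) :=
      R⁻¹ • ContinuousMultilinearMap.compContinuousLinearMapL
        (fun _ : Fin k => R⁻¹ • ContinuousLinearMap.id ℝ (EuclideanSpace ℝ (Fin 3))) with hΨ
    have hΨapply : ∀ M : ContinuousMultilinearMap ℝ (fun _ : Fin k => EuclideanSpace ℝ (Fin 3)) (EuclideanSpace ℝ (Fin 3)),
        Ψ M = R⁻¹ • M.compContinuousLinearMap
          (fun _ => R⁻¹ • ContinuousLinearMap.id ℝ (EuclideanSpace ℝ (Fin 3))) := fun M => rfl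
    have hΨlip : LipschitzWith ‖Ψ‖₊ Ψ := Ψ.lipschitz
    have hψlip : LipschitzWith (max (Real.toNNReal (R ^ 2)⁻¹) (Real.toNNReal R⁻¹)) ψ :=
      lipschitzWith_stAffine (inv_nonneg.2 hR2.le) (inv_nonneg.2 hR.le) _ _
    have hcomp1 : HolderOnWith (C * max (Real.toNNReal (R ^ 2)⁻¹) (Real.toNNReal R⁻¹) ^ (α : ℝ)) (α * 1)
        ((fun w : ℝ × EuclideanSpace ℝ (Fin 3) => iteratedFDeriv ℝ k (W w.1) w.2) ∘ ψ)
        (parabolicCylinder (R / 2) z₁) :=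
      hHk.comp (hψlip.lipschitzOnWith.holderOnWith) fun z hz => hψmem z hz
    have hcomp2 := (hΨlip.lipschitzOnWith (s := univ)).holderOnWith.comp hcomp1 (fun z _ => mem_univ _)
    refine ⟨‖Ψ‖₊ * (C * max (Real.toNNReal (R ^ 2)⁻¹) (Real.toNNReal R⁻¹) ^ (α : ℝ)) ^ ((1 : ℝ≥0) : ℝ),
      1 * (α * 1), by positivity, ?_⟩
    intro z hz z' hz'
    have e : ∀ w ∈ parabolicCylinder (R / 2) z₁, iteratedFDeriv ℝ k (V w.1) w.2 =
        (Ψ ∘ ((fun w : ℝ × EuclideanSpace ℝ (Fin 3) => iteratedFDeriv ℝ k (W w.1) w.2) ∘ ψ)) w := by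
      intro w hw
      rw [comp_apply, comp_apply, hΨapply, hformula k w hw]
    show edist (iteratedFDeriv ℝ k (V z.1) z.2) (iteratedFDeriv ℝ k (V z'.1) z'.2) ≤ _
    rw [e z hz, e z' hz']
    exact hcomp2 z hz z' hz'
  · -- the bounds `‖D_x^k V‖ ≤ R^{-(k+1)} c k`
    intro k z hz
    rw [hformula k z hz, norm_smul, norm_inv, Real.norm_of_nonneg hR.le, pow_succ, mul_comm (R⁻¹ ^ k),
      mul_assoc]
    refine mul_le_mul_of_nonneg_left ?_ (inv_nonneg.2 hR.le)
    refine (ContinuousMultilinearMap.norm_compContinuousLinearMap_le _ _).trans ?_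
    rw [Finset.prod_const, Finset.card_univ, Fintype.card_fin, mul_comm]
    have hn : ‖R⁻¹ • ContinuousLinearMap.id ℝ (EuclideanSpace ℝ (Fin 3))‖ ≤ R⁻¹ := by
      rw [norm_smul, norm_inv, Real.norm_of_nonneg hR.le]
      exact mul_le_of_le_one_right (inv_nonneg.2 hR.le) ContinuousLinearMap.norm_id_le
    exact mul_le_mul (pow_le_pow_left₀ (norm_nonneg _) hn k) (hb k (ψ z) (hψmem z hz))
      (norm_nonneg _) (pow_nonneg (inv_nonneg.2 hR.le) k)

end Transport

end Literature.Analysis.FluidPDE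

end
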